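import Summits.BirchSwinnertonDyer.Rank2.MuCertificateAtTwoCriterion
import HarnessLib

/-!
# The NO-GROWTH `μ`-criterion for `Λ = ℤ_p⟦T⟧`-modules: `μ(M) ≥ 1` forces `#(M/(p,T^m)M)` to grow by a factor
# `≥ p` at EVERY step `m ↦ m+1`

Planner p2 GEN 48 kernel, part 1 of 2 (cell bsd-rank2, HOME `run/shared/lean/pub/bsd-rank2/`, file
`HOME/p2/g48/lean/MuGrowthCriterion.lean`; memo `HOME/p2/g48/NO-GROWTH-CERT.md`).  Pure commutative algebra over
`Λ = ℤ_p⟦T⟧` (any prime `p`), extending the GEN-47 one-layer criterion `#(M/(p,T^m)M) < p^m ⟹ μ(M) = 0`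
(`Rank2/MuCertificateAtTwoCriterion.lean`, tree).  Write `𝔞_k = (p, T^k)`; for a finitely generated torsion
`Λ`-module `M` the quotients `M/𝔞_k M` form a tower `… ↠ M/𝔞_{k+1}M ↠ M/𝔞_k M ↠ … ↠ M/𝔞_0 M = 0`.

* `mem_span_pair_smul_top_iff`: `x ∈ (a,b)M ↔ x = a y + b z`; `span_pair_pow_anti`, `span_pair_pow_smul_top_anti`:
  the tower is monotone.
* `span_pair_pow_smul_top_eq_of_step` (**iteration**): `𝔞_i M ⊆ 𝔞_{i+1} M ⟹ 𝔞_m M = 𝔞_i M` for all `m ≥ i`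
  (`T^i M ⊆ pM + T^{i+1}M` iterates to `T^i M ⊆ pM + T^m M`).
* `muInvariant_eq_zero_of_smul_top_le_succ`: `𝔞_i M ⊆ 𝔞_{i+1} M` (with `M/𝔞_i M` finite) `⟹ μ(M) = 0` — all
  `M/𝔞_m M` then have the same size `c < p^{i+c}`, and the GEN-47 criterion fires at `m = i + c`.
* `muInvariant_eq_zero_of_natCard_quotient_le` (**no growth**): `i < j`, `#(M/𝔞_j M) ≤ #(M/𝔞_i M) ⟹ μ(M) = 0`
  (an onto map of finite sets of equal size is a bijection, so `𝔞_i M = 𝔞_j M ⊆ 𝔞_{i+1} M`).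
* `mul_natCard_quotient_le_succ` (**one step costs a factor `p`**): unless `𝔞_k M ⊆ 𝔞_{k+1} M`,
  `p · #(M/𝔞_k M) ≤ #(M/𝔞_{k+1} M)` (`𝔞_k M/𝔞_{k+1} M` is a non-zero group killed by `p`, so `p` divides its order).
* `muInvariant_eq_zero_of_natCard_quotient_lt_mul` (**sharp counting form**): `i ≤ j`,
  `#(M/𝔞_j M) < p^{j−i} · #(M/𝔞_i M) ⟹ μ(M) = 0`.  At `i = 0` (`#(M/𝔞_0 M) = 1`) this is the GEN-47 criterion; at
  `j = i+1` it contains the no-growth criterion.  Contrapositive: `μ(M) ≥ 1 ⟹ #(M/(p,T^m)M) ≥ p^{m−i} #(M/(p,T^i)M)`,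
  i.e. with `V = M/pM` over `𝔽_p⟦T⟧` every graded piece `T^kV/T^{k+1}V` is non-zero.
* layer forms via `(p, T^{p^n}) = (p, ω_n)`, `ω_n = (1+T)^{p^n} − 1` (tree `span_C_X_pow_eq_span_C_omega`):
  `muInvariant_eq_zero_of_natCard_layerQuotient_le`, `…_layerQuotient_lt_mul`.

Part 2 (`MuCertificateAtTwoGrowth.lean`) applies this to `X_p(E/ℚ_∞)` and to the `2`-adic rank-`2` dichotomy.
B1 HONESTY: pure algebra; no arithmetic statement is made in this file.

## References
* L. C. Washington, *Introduction to Cyclotomic Fields*, GTM 83, §13.2 (Thm. 13.12, Lemma 13.7). [Washington1997]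
* R. Greenberg, LNM 1716 (1999), §1, Thm. 1.10, Conj. 1.11. [GreenbergLNM1716]
-/

set_option autoImplicit false

noncomputable section

open scoped Classical

open Literature.NumberTheory.EllipticCurves Literature.NumberTheory.EllipticCurves.IwasawaAlgebra

namespace Summit.BirchSwinnertonDyer.Rank2

/-! ### §1. Algebra: the no-growth criterion `#(M/(p,T^j)M) ≤ #(M/(p,T^i)M) (i < j) ⟹ μ(M) = 0` -/

section General

variable {R : Type*} [CommRing R] {M : Type*} [AddCommGroup M] [Module R M]

/-- Membership in `(a, b)·M`: `x ∈ (a,b)M ↔ ∃ y z, a y + b z = x`. [cite: Washington1997, §13.2] -/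
theorem mem_span_pair_smul_top_iff (a b : R) (x : M) :
    x ∈ Ideal.span {a, b} • (⊤ : Submodule R M) ↔ ∃ y z : M, a • y + b • z = x := by
  constructor
  · intro hx
    refine Submodule.smul_induction_on hx ?_ ?_
    · intro r hr n _
      obtain ⟨c, d, rfl⟩ := Ideal.mem_span_pair.mp hr
      refine ⟨c • n, d • n, ?_⟩
      rw [add_smul, mul_comm c a, mul_comm d b, mul_smul, mul_smul]
    · rintro x y ⟨y₁, z₁, rfl⟩ ⟨y₂, z₂, rfl⟩
      exact ⟨y₁ + y₂, z₁ + z₂, by rw [smul_add, smul_add]; abel⟩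
  · rintro ⟨y, z, rfl⟩
    exact Submodule.add_mem _
      (Submodule.smul_mem_smul (Ideal.subset_span (by simp)) Submodule.mem_top)
      (Submodule.smul_mem_smul (Ideal.subset_span (by simp)) Submodule.mem_top)

/-- `(a, t^j) ⊆ (a, t^i)` for `i ≤ j`. [cite: Washington1997, §13.2] -/
theorem span_pair_pow_anti (a t : R) {i j : ℕ} (hij : i ≤ j) :
    Ideal.span {a, t ^ j} ≤ Ideal.span {a, t ^ i} := by
  rw [Ideal.span_le]
  intro r hr
  simp only [Set.mem_insert_iff, Set.mem_singleton_iff] at hr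
  rcases hr with rfl | rfl
  · exact Ideal.subset_span (by simp)
  · obtain ⟨k, rfl⟩ := Nat.exists_eq_add_of_le hij
    rw [pow_add]
    exact Ideal.mul_mem_right _ _ (Ideal.subset_span (by simp))

/-- `(a, t^j)M ⊆ (a, t^i)M` for `i ≤ j`. [cite: Washington1997, §13.2] -/
theorem span_pair_pow_smul_top_anti (a t : R) {i j : ℕ} (hij : i ≤ j) :
    Ideal.span {a, t ^ j} • (⊤ : Submodule R M) ≤ Ideal.span {a, t ^ i} • (⊤ : Submodule R M) :=
  Submodule.smul_mono_left (span_pair_pow_anti a t hij)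

/-- **The iteration.** If `(a, t^i)M ⊆ (a, t^{i+1})M` — i.e. `t^i M ⊆ aM + t^{i+1}M` — then
`(a, t^m)M = (a, t^i)M` for every `m ≥ i`: `t^m M = t^{m-i} t^i M ⊆ t^{m-i}(aM + t^{i+1}M) ⊆ aM + t^{m+1}M`, so the
chain `(a,t^i)M ⊇ (a,t^{i+1})M ⊇ …` is constant. [cite: Washington1997, §13.2 (Lemma 13.7ff)] -/
theorem span_pair_pow_smul_top_eq_of_step (a t : R) {i : ℕ}
    (h : Ideal.span {a, t ^ i} • (⊤ : Submodule R M) ≤ Ideal.span {a, t ^ (i + 1)} • (⊤ : Submodule R M))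
    {m : ℕ} (him : i ≤ m) :
    Ideal.span {a, t ^ m} • (⊤ : Submodule R M) = Ideal.span {a, t ^ i} • (⊤ : Submodule R M) := by
  refine le_antisymm (span_pair_pow_smul_top_anti a t him) ?_
  induction m, him using Nat.le_induction with
  | base => exact le_rfl
  | succ m him ih =>
    refine ih.trans ?_
    intro x hx
    obtain ⟨y, z, rfl⟩ := (mem_span_pair_smul_top_iff a (t ^ m) x).mp hx
    refine Submodule.add_mem _ ((mem_span_pair_smul_top_iff a (t ^ (m + 1)) _).mpr ⟨y, 0, by simp⟩) ?_
    -- `t^m z = t^{m-i} (t^i z)` with `t^i z ∈ (a, t^i)M ⊆ (a, t^{i+1})M`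
    obtain ⟨k, rfl⟩ := Nat.exists_eq_add_of_le him
    have hiz : t ^ i • z ∈ Ideal.span {a, t ^ (i + 1)} • (⊤ : Submodule R M) :=
      h ((mem_span_pair_smul_top_iff a (t ^ i) _).mpr ⟨0, z, by simp⟩)
    obtain ⟨y', z', hyz⟩ := (mem_span_pair_smul_top_iff a (t ^ (i + 1)) _).mp hiz
    refine (mem_span_pair_smul_top_iff a (t ^ (i + k + 1)) _).mpr ⟨t ^ k • y', z', ?_⟩
    calc a • t ^ k • y' + t ^ (i + k + 1) • z'
        = t ^ k • (a • y' + t ^ (i + 1) • z') := by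
          rw [smul_add, ← mul_smul, ← mul_smul, ← mul_smul, mul_comm (t ^ k) a, ← pow_add,
            show k + (i + 1) = i + k + 1 by omega]
      _ = t ^ k • (t ^ i • z) := by rw [hyz]
      _ = t ^ (i + k) • z := by rw [← mul_smul, ← pow_add, Nat.add_comm k i]

end General

section MuGrowth

variable (p : ℕ) [Fact p.Prime]

/-- **`(p, T^i)M ⊆ (p, T^{i+1})M ⟹ μ(M) = 0`** for a finitely generated torsion `Λ`-module `M` with `M/(p,T^i)M`
finite: by the iteration all quotients `M/(p,T^m)M`, `m ≥ i`, have the same finite size `c`, and `c < p^m` for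
`m = i + c`, so the one-layer criterion `muInvariant_eq_zero_of_natCard_quotient_lt_pow` (tree) applies.
[cite: Washington1997, §13.2, Thm. 13.12, Lemma 13.7] [cite: GreenbergLNM1716, §1, Thm. 1.10, Conj. 1.11] -/
theorem muInvariant_eq_zero_of_smul_top_le_succ {M : Type*} [AddCommGroup M]
    [Module (IwasawaAlgebra p) M] [Module.Finite (IwasawaAlgebra p) M]
    (hM : Module.IsTorsion (IwasawaAlgebra p) M) (i : ℕ)
    [Finite (M ⧸ (Ideal.span {PowerSeries.C (p : ℤ_[p]), (PowerSeries.X : IwasawaAlgebra p) ^ i} •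
      (⊤ : Submodule (IwasawaAlgebra p) M)))]
    (h : Ideal.span {PowerSeries.C (p : ℤ_[p]), (PowerSeries.X : IwasawaAlgebra p) ^ i} •
        (⊤ : Submodule (IwasawaAlgebra p) M) ≤
      Ideal.span {PowerSeries.C (p : ℤ_[p]), (PowerSeries.X : IwasawaAlgebra p) ^ (i + 1)} •
        (⊤ : Submodule (IwasawaAlgebra p) M)) :
    muInvariant p M = 0 := by
  have hp1 : 1 < p := (Fact.out : p.Prime).one_lt
  set c : ℕ := Nat.card (M ⧸ (Ideal.span {PowerSeries.C (p : ℤ_[p]), (PowerSeries.X : IwasawaAlgebra p) ^ i} •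
      (⊤ : Submodule (IwasawaAlgebra p) M))) with hc
  have heq : Ideal.span {PowerSeries.C (p : ℤ_[p]), (PowerSeries.X : IwasawaAlgebra p) ^ (i + c)} •
        (⊤ : Submodule (IwasawaAlgebra p) M) =
      Ideal.span {PowerSeries.C (p : ℤ_[p]), (PowerSeries.X : IwasawaAlgebra p) ^ i} •
        (⊤ : Submodule (IwasawaAlgebra p) M) :=
    span_pair_pow_smul_top_eq_of_step _ _ h (Nat.le_add_right i c)
  haveI : Finite (M ⧸ (Ideal.span {PowerSeries.C (p : ℤ_[p]), (PowerSeries.X : IwasawaAlgebra p) ^ (i + c)} •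
      (⊤ : Submodule (IwasawaAlgebra p) M))) := by
    rw [heq]; infer_instance
  have hcard : Nat.card (M ⧸ (Ideal.span {PowerSeries.C (p : ℤ_[p]),
      (PowerSeries.X : IwasawaAlgebra p) ^ (i + c)} • (⊤ : Submodule (IwasawaAlgebra p) M))) = c :=
    Nat.card_congr (Submodule.quotEquivOfEq _ _ heq).toEquiv
  refine muInvariant_eq_zero_of_natCard_quotient_lt_pow p hM (i + c) ?_
  rw [hcard]
  calc c < p ^ c := Nat.lt_pow_self hp1
    _ ≤ p ^ (i + c) := Nat.pow_le_pow_right hp1.le (Nat.le_add_left c i)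

/-- **THE NO-GROWTH CRITERION.** `M` a finitely generated torsion `Λ = ℤ_p⟦T⟧`-module, `i < j`, `M/(p,T^j)M`
finite; if `#(M/(p,T^j)M) ≤ #(M/(p,T^i)M)` (hence `=`: the quotient map `M/(p,T^j)M ↠ M/(p,T^i)M` is onto),
then `μ(M) = 0`.  Proof: the onto map between finite sets of the same size is a bijection, so
`(p,T^i)M = (p,T^j)M ⊆ (p,T^{i+1})M` and `muInvariant_eq_zero_of_smul_top_le_succ` applies.  Equivalently
`μ(M) ≥ 1 ⟹ #(M/(p,T^m)M)` is strictly increasing in `m`.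
[cite: Washington1997, §13.2, Thm. 13.12, Lemma 13.7] [cite: GreenbergLNM1716, §1, Thm. 1.10, Conj. 1.11] -/
theorem muInvariant_eq_zero_of_natCard_quotient_le {M : Type*} [AddCommGroup M]
    [Module (IwasawaAlgebra p) M] [Module.Finite (IwasawaAlgebra p) M]
    (hM : Module.IsTorsion (IwasawaAlgebra p) M) {i j : ℕ} (hij : i < j)
    [Finite (M ⧸ (Ideal.span {PowerSeries.C (p : ℤ_[p]), (PowerSeries.X : IwasawaAlgebra p) ^ j} •
      (⊤ : Submodule (IwasawaAlgebra p) M)))]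
    (hle : Nat.card (M ⧸ (Ideal.span {PowerSeries.C (p : ℤ_[p]), (PowerSeries.X : IwasawaAlgebra p) ^ j} •
        (⊤ : Submodule (IwasawaAlgebra p) M))) ≤
      Nat.card (M ⧸ (Ideal.span {PowerSeries.C (p : ℤ_[p]), (PowerSeries.X : IwasawaAlgebra p) ^ i} •
        (⊤ : Submodule (IwasawaAlgebra p) M)))) :
    muInvariant p M = 0 := by
  set I : Submodule (IwasawaAlgebra p) M :=
    Ideal.span {PowerSeries.C (p : ℤ_[p]), (PowerSeries.X : IwasawaAlgebra p) ^ i} •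
      (⊤ : Submodule (IwasawaAlgebra p) M) with hI
  set J : Submodule (IwasawaAlgebra p) M :=
    Ideal.span {PowerSeries.C (p : ℤ_[p]), (PowerSeries.X : IwasawaAlgebra p) ^ j} •
      (⊤ : Submodule (IwasawaAlgebra p) M) with hJ
  have hJI : J ≤ I := span_pair_pow_smul_top_anti _ _ hij.le
  -- the quotient map `M/J ↠ M/I` is a bijection of finite sets
  have hsurj : Function.Surjective (Submodule.factor hJI) := Submodule.factor_surjective hJI
  haveI : Finite (M ⧸ I) := Finite.of_surjective _ hsurj
  have hbij : Function.Bijective (Submodule.factor hJI) := hsurj.bijective_of_nat_card_le hle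
  -- hence `I ≤ J`
  have hIJ : I ≤ J := by
    intro x hx
    have h0 : Submodule.factor hJI (Submodule.mkQ J x) = 0 := by
      rw [Submodule.factor_mk]; exact (Submodule.Quotient.mk_eq_zero I).mpr hx
    have hx0 : Submodule.mkQ J x = 0 := hbij.1 (by rw [h0, map_zero])
    exact (Submodule.Quotient.mk_eq_zero J).mp hx0
  -- and `J ≤ (p, T^{i+1})M`
  haveI : Finite (M ⧸ I) := inferInstance
  exact muInvariant_eq_zero_of_smul_top_le_succ p hM i
    (hIJ.trans (span_pair_pow_smul_top_anti _ _ (Nat.succ_le_of_lt hij)))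

/-- **One step of the tower costs a factor `p`.**  If `(p,T^k)M ⊄ (p,T^{k+1})M` then
`p · #(M/(p,T^k)M) ≤ #(M/(p,T^{k+1})M)`: `#(M/𝔞_{k+1}M) = #(𝔞_k M/𝔞_{k+1} M) · #(M/𝔞_k M)` and the first factor is
the order of a non-zero group killed by `p` (as `p ∈ 𝔞_{k+1}`), hence divisible by `p`.
[cite: Washington1997, §13.2, Lemma 13.7] -/
theorem mul_natCard_quotient_le_succ {M : Type*} [AddCommGroup M] [Module (IwasawaAlgebra p) M] (k : ℕ)
    [Finite (M ⧸ (Ideal.span {PowerSeries.C (p : ℤ_[p]), (PowerSeries.X : IwasawaAlgebra p) ^ (k + 1)} •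
      (⊤ : Submodule (IwasawaAlgebra p) M)))]
    (hne : ¬ (Ideal.span {PowerSeries.C (p : ℤ_[p]), (PowerSeries.X : IwasawaAlgebra p) ^ k} •
        (⊤ : Submodule (IwasawaAlgebra p) M) ≤
      Ideal.span {PowerSeries.C (p : ℤ_[p]), (PowerSeries.X : IwasawaAlgebra p) ^ (k + 1)} •
        (⊤ : Submodule (IwasawaAlgebra p) M))) :
    p * Nat.card (M ⧸ (Ideal.span {PowerSeries.C (p : ℤ_[p]), (PowerSeries.X : IwasawaAlgebra p) ^ k} •
        (⊤ : Submodule (IwasawaAlgebra p) M))) ≤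
      Nat.card (M ⧸ (Ideal.span {PowerSeries.C (p : ℤ_[p]), (PowerSeries.X : IwasawaAlgebra p) ^ (k + 1)} •
        (⊤ : Submodule (IwasawaAlgebra p) M))) := by
  set I : Submodule (IwasawaAlgebra p) M :=
    Ideal.span {PowerSeries.C (p : ℤ_[p]), (PowerSeries.X : IwasawaAlgebra p) ^ k} •
      (⊤ : Submodule (IwasawaAlgebra p) M) with hI
  set J : Submodule (IwasawaAlgebra p) M :=
    Ideal.span {PowerSeries.C (p : ℤ_[p]), (PowerSeries.X : IwasawaAlgebra p) ^ (k + 1)} •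
      (⊤ : Submodule (IwasawaAlgebra p) M) with hJ
  have hJI : J ≤ I := span_pair_pow_smul_top_anti _ _ (Nat.le_succ k)
  have hC : ((p : ℕ) : IwasawaAlgebra p) = PowerSeries.C (p : ℤ_[p]) :=
    (map_natCast (PowerSeries.C (R := ℤ_[p])) p).symm
  -- `#(M/J) = #(I/J) · #(M/I)`
  have h1 := Submodule.card_eq_card_quotient_mul_card (I.map J.mkQ)
  rw [Nat.card_congr (Submodule.quotientQuotientEquivQuotient J I hJI).toEquiv] at h1
  rw [h1]
  refine Nat.mul_le_mul_right _ ?_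
  -- a non-zero element of `I/J` of additive order `p`
  obtain ⟨x, hxI, hxJ⟩ := SetLike.not_le_iff_exists.mp hne
  have hs_mem : J.mkQ x ∈ I.map J.mkQ := Submodule.mem_map_of_mem hxI
  have hs_ne : (⟨J.mkQ x, hs_mem⟩ : I.map J.mkQ) ≠ 0 := by
    intro h0
    have h0' : J.mkQ x = 0 := congrArg Subtype.val h0
    exact hxJ ((Submodule.Quotient.mk_eq_zero J).mp h0')
  have hpx : p • J.mkQ x = 0 := by
    rw [← map_nsmul, ← Nat.cast_smul_eq_nsmul (IwasawaAlgebra p) p x, hC]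
    exact (Submodule.Quotient.mk_eq_zero J).mpr
      (Submodule.smul_mem_smul (Ideal.subset_span (by simp)) Submodule.mem_top)
  have hps : p • (⟨J.mkQ x, hs_mem⟩ : I.map J.mkQ) = 0 := Subtype.ext (by simpa using hpx)
  have hord : addOrderOf (⟨J.mkQ x, hs_mem⟩ : I.map J.mkQ) = p := addOrderOf_eq_prime hps hs_ne
  have hdvd : p ∣ Nat.card (I.map J.mkQ) := by
    have h := addOrderOf_dvd_natCard (⟨J.mkQ x, hs_mem⟩ : I.map J.mkQ)
    rwa [hord] at h
  exact Nat.le_of_dvd Nat.card_pos hdvd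

/-- **THE SHARP COUNTING CRITERION.** `M` a finitely generated torsion `Λ = ℤ_p⟦T⟧`-module, `i ≤ j`,
`M/(p,T^j)M` finite; if `#(M/(p,T^j)M) < p^{j−i} · #(M/(p,T^i)M)` then `μ(M) = 0`.  For if `μ(M) ≠ 0`, no step of
the tower `M/𝔞_j M ↠ … ↠ M/𝔞_i M` collapses (`muInvariant_eq_zero_of_smul_top_le_succ`), so each step costs a
factor `p` (`mul_natCard_quotient_le_succ`).  `i = 0`: the GEN-47 criterion `#(M/(p,T^j)M) < p^j`; `j = i+1`: the
no-growth criterion. [cite: Washington1997, §13.2, Thm. 13.12, Lemma 13.7] [cite: GreenbergLNM1716, §1, Thm. 1.10] -/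
theorem muInvariant_eq_zero_of_natCard_quotient_lt_mul {M : Type*} [AddCommGroup M]
    [Module (IwasawaAlgebra p) M] [Module.Finite (IwasawaAlgebra p) M]
    (hM : Module.IsTorsion (IwasawaAlgebra p) M) {i j : ℕ} (hij : i ≤ j)
    [Finite (M ⧸ (Ideal.span {PowerSeries.C (p : ℤ_[p]), (PowerSeries.X : IwasawaAlgebra p) ^ j} •
      (⊤ : Submodule (IwasawaAlgebra p) M)))]
    (hlt : Nat.card (M ⧸ (Ideal.span {PowerSeries.C (p : ℤ_[p]), (PowerSeries.X : IwasawaAlgebra p) ^ j} •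
        (⊤ : Submodule (IwasawaAlgebra p) M))) <
      p ^ (j - i) * Nat.card (M ⧸ (Ideal.span {PowerSeries.C (p : ℤ_[p]), (PowerSeries.X : IwasawaAlgebra p) ^ i} •
        (⊤ : Submodule (IwasawaAlgebra p) M)))) :
    muInvariant p M = 0 := by
  by_contra hμ
  -- abbreviation for the tower
  let Q : ℕ → Submodule (IwasawaAlgebra p) M := fun m =>
    Ideal.span {PowerSeries.C (p : ℤ_[p]), (PowerSeries.X : IwasawaAlgebra p) ^ m} •
      (⊤ : Submodule (IwasawaAlgebra p) M)
  have hQ : ∀ m, Q m = Ideal.span {PowerSeries.C (p : ℤ_[p]), (PowerSeries.X : IwasawaAlgebra p) ^ m} •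
      (⊤ : Submodule (IwasawaAlgebra p) M) := fun m => rfl
  have hfin : ∀ m, m ≤ j → Finite (M ⧸ Q m) := fun m hm =>
    Finite.of_surjective _ (Submodule.factor_surjective (span_pair_pow_smul_top_anti
      (PowerSeries.C (p : ℤ_[p])) (PowerSeries.X : IwasawaAlgebra p) (M := M) hm))
  -- claim: `p^{m-i} #(M/Q i) ≤ #(M/Q m)` for `i ≤ m ≤ j`
  have hclaim : ∀ m, i ≤ m → m ≤ j → p ^ (m - i) * Nat.card (M ⧸ Q i) ≤ Nat.card (M ⧸ Q m) := by
    intro m him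
    induction m, him using Nat.le_induction with
    | base => intro _; simp
    | succ m him ih =>
      intro hmj
      have ih' := ih (Nat.le_of_succ_le hmj)
      haveI : Finite (M ⧸ Q (m + 1)) := hfin (m + 1) hmj
      haveI : Finite (M ⧸ Q m) := hfin m (Nat.le_of_succ_le hmj)
      by_cases hstep : Q m ≤ Q (m + 1)
      · exact absurd (muInvariant_eq_zero_of_smul_top_le_succ p hM m hstep) hμ
      · have hmul := mul_natCard_quotient_le_succ p (M := M) m hstep
        calc p ^ (m + 1 - i) * Nat.card (M ⧸ Q i)
            = p * (p ^ (m - i) * Nat.card (M ⧸ Q i)) := by rw [Nat.succ_sub him, pow_succ]; ring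
          _ ≤ p * Nat.card (M ⧸ Q m) := Nat.mul_le_mul_left _ ih'
          _ ≤ Nat.card (M ⧸ Q (m + 1)) := hmul
  exact absurd hlt (not_lt.mpr (hclaim j hij le_rfl))

/-- The no-growth criterion AT LAYERS `n < n + 1`, `ω_n = (1+T)^{p^n} − 1`:
`#(M/(p,ω_{n+1})M) ≤ #(M/(p,ω_n)M) ⟹ μ(M) = 0` (`(p, T^{p^n}) = (p, ω_n)`, tree `span_C_X_pow_eq_span_C_omega`).
For `M = X_p(E/ℚ_∞)`: `M/(p,ω_n)M = ((Sel_{p^∞}(E/ℚ_∞)[p])^{Γ_n})^∨`, so the input is `#S_{n+1} = #S_n`.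
[cite: Washington1997, §13.2 (ω_n), Thm. 13.12] [cite: GreenbergLNM1716, §1, Thm. 1.10, Conj. 1.11] -/
theorem muInvariant_eq_zero_of_natCard_layerQuotient_le {M : Type*} [AddCommGroup M]
    [Module (IwasawaAlgebra p) M] [Module.Finite (IwasawaAlgebra p) M]
    (hM : Module.IsTorsion (IwasawaAlgebra p) M) (n : ℕ)
    [Finite (M ⧸ (Ideal.span {PowerSeries.C (p : ℤ_[p]),
      (1 + PowerSeries.X : IwasawaAlgebra p) ^ (p ^ (n + 1)) - 1} • (⊤ : Submodule (IwasawaAlgebra p) M)))]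
    (hle : Nat.card (M ⧸ (Ideal.span {PowerSeries.C (p : ℤ_[p]),
        (1 + PowerSeries.X : IwasawaAlgebra p) ^ (p ^ (n + 1)) - 1} • (⊤ : Submodule (IwasawaAlgebra p) M))) ≤
      Nat.card (M ⧸ (Ideal.span {PowerSeries.C (p : ℤ_[p]),
        (1 + PowerSeries.X : IwasawaAlgebra p) ^ (p ^ n) - 1} • (⊤ : Submodule (IwasawaAlgebra p) M)))) :
    muInvariant p M = 0 := by
  have hp1 : 1 < p := (Fact.out : p.Prime).one_lt
  have h0 := span_C_X_pow_eq_span_C_omega p n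
  have h1 := span_C_X_pow_eq_span_C_omega p (n + 1)
  haveI : Finite (M ⧸ (Ideal.span {PowerSeries.C (p : ℤ_[p]), (PowerSeries.X : IwasawaAlgebra p) ^ (p ^ (n + 1))} •
      (⊤ : Submodule (IwasawaAlgebra p) M))) := by rw [h1]; infer_instance
  rw [← h0, ← h1] at hle
  exact muInvariant_eq_zero_of_natCard_quotient_le p hM (Nat.pow_lt_pow_right hp1 (Nat.lt_succ_self n)) hle

/-- The sharp counting criterion AT LAYERS `n ≤ n'`: `#(M/(p,ω_{n'})M) < p^{p^{n'} − p^n} · #(M/(p,ω_n)M) ⟹ μ(M) = 0`.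
[cite: Washington1997, §13.2 (ω_n), Thm. 13.12] [cite: GreenbergLNM1716, §1, Thm. 1.10, Conj. 1.11] -/
theorem muInvariant_eq_zero_of_natCard_layerQuotient_lt_mul {M : Type*} [AddCommGroup M]
    [Module (IwasawaAlgebra p) M] [Module.Finite (IwasawaAlgebra p) M]
    (hM : Module.IsTorsion (IwasawaAlgebra p) M) {n n' : ℕ} (hnn' : n ≤ n')
    [Finite (M ⧸ (Ideal.span {PowerSeries.C (p : ℤ_[p]),
      (1 + PowerSeries.X : IwasawaAlgebra p) ^ (p ^ n') - 1} • (⊤ : Submodule (IwasawaAlgebra p) M)))]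
    (hlt : Nat.card (M ⧸ (Ideal.span {PowerSeries.C (p : ℤ_[p]),
        (1 + PowerSeries.X : IwasawaAlgebra p) ^ (p ^ n') - 1} • (⊤ : Submodule (IwasawaAlgebra p) M))) <
      p ^ (p ^ n' - p ^ n) * Nat.card (M ⧸ (Ideal.span {PowerSeries.C (p : ℤ_[p]),
        (1 + PowerSeries.X : IwasawaAlgebra p) ^ (p ^ n) - 1} • (⊤ : Submodule (IwasawaAlgebra p) M)))) :
    muInvariant p M = 0 := by
  have hp1 : 1 < p := (Fact.out : p.Prime).one_lt
  have h0 := span_C_X_pow_eq_span_C_omega p n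
  have h1 := span_C_X_pow_eq_span_C_omega p n'
  haveI : Finite (M ⧸ (Ideal.span {PowerSeries.C (p : ℤ_[p]), (PowerSeries.X : IwasawaAlgebra p) ^ (p ^ n')} •
      (⊤ : Submodule (IwasawaAlgebra p) M))) := by rw [h1]; infer_instance
  rw [← h0, ← h1] at hlt
  exact muInvariant_eq_zero_of_natCard_quotient_lt_mul p hM (Nat.pow_le_pow_right hp1.le hnn') hlt

end MuGrowth

end Summit.BirchSwinnertonDyer.Rank2

end
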